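import Summits.BirchSwinnertonDyer.BirchSwinnertonDyer.Theorems.SylvesterTwoHeegnerIndexUpperOffV0StepB
import Literature.NumberTheory.EllipticCurves.HeegnerPointsKolyvaginPrimaryCebotarevFrobeniusProofs
import Literature.NumberTheory.Automorphic.ChebotarevArtinRepHolds
import HarnessLib

/-!
# K7t crux `UpperOffV0HSY` (item 19581): McCallum's Cor. 3.2 at `p = 2` for the CM curves
# `y² = x³ − c` — Kolyvagin primes with prescribed local orders at level `2^M`

Route `SylvesterTwoHeegnerIndex` (cell bsd-cm, rung K7t).  McCallum 1991, Cor. 3.2 (the `cebotarev`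
field of the tree's `KolyvaginDescent.HypothesesM`): independent `τ`-eigenclasses
`c_i ∈ H¹(K, E[p^M])` acquire prescribed local orders `ord c_{i,λ} = p^{N_i}` at infinitely many
Kolyvagin primes.  The tree proves it for `p` odd with `ρ̄_{E,p}` onto
(`exists_kolyvaginPrime_gt_pow`).  Here: **`p = 2`, `E = E_W` a `ℚ`-model of `y² = x³ − c`,
`K` imaginary quadratic with `∛c ∉ K` and `ω ∉ K`** (`K ≠ ℚ(√−3)`), from

* Step B at `2` (`exists_h1Eval_conj_mul_order_two`, this seat), and
* the tree's p-INDEPENDENT Čebotarev Steps C–G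
  (`exists_kolyvaginPrime_gt_of_galoisElement`, `Automorphic.chebotarev_artinRep` as hypothesis),

with the one new Galois input `transport_smul_eq_sq_of_cube_root` — the transported complex
conjugation `τ = e ∘ c₀ ∘ e⁻¹` maps a primitive cube root of unity `ω ∈ K̄` to `ω²`
(`RatClosure.smul_eq_inv_of_pow_eq_one`: `c₀ ζ = ζ⁻¹`).

* `exists_kolyvaginPrime_gt_twoPow` — **Cor. 3.2 at `2`**: for every `b` a prime `ℓ > b`,
  `ℓ ∤ 2N d_K`, `(ℓ)` prime in `𝓞_K`, `Frob(ℓ) = Frob(∞)` in `Gal(K(E[2^M])/ℚ)`, with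
  `2^{N_i} c_i ∈ ker loc_λ` and `2^{N_i−1} c_i ∉ ker loc_λ` at the place `λ ∋ ℓ`.

NOT the crux: this is the `cebotarev` input of a 2-adic Kolyvagin descent for E_p; the descent count
with the `τ`-eigenspace defect (`…EisensteinConj`) and the duality field are not done, and the sharp
bound off 𝒱₀ stays open (B14 = O12 open as a class).
-/

noncomputable section

open scoped Classical
open Field WeierstrassCurve NumberField IsDedekindDomain Literature.NumberTheory.EllipticCurves
  Literature.NumberTheory.GaloisRepresentations

set_option autoImplicit false
set_option linter.dupNamespace false

namespace Summit.BirchSwinnertonDyer.BirchSwinnertonDyer.Theorems.SylvesterTwoUpper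

universe u

variable {K : Type u} [Field K] [NumberField K]

/-- **The transported complex conjugation inverts cube roots of unity**: for `c₀ ∈ Γ_ℚ` a complex
conjugation and `τ = absGaloisTransport c₀` on `K̄`, `τ(ω) = ω²` for `ω² + ω + 1 = 0`
(`c₀ ζ = ζ⁻¹` on `μ₃ ⊂ ℚ̄`, `RatClosure.smul_eq_inv_of_pow_eq_one`). [folklore] -/
theorem transport_smul_eq_sq_of_cube_root {c₀ : absoluteGaloisGroup ℚ}
    (hc₀ : IsComplexConjugation (Rat.castHom ℝ) c₀) {ω : AlgebraicClosure K}
    (hω : ω ^ 2 + ω + 1 = 0) :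
    (absGaloisTransport (K := ℚ) (L := K) c₀).toRingEquiv ω = ω ^ 2 := by
  have hω3 : ω ^ 3 = 1 := by linear_combination (ω - 1) * hω
  have hω0 : ω ≠ 0 := by
    rintro rfl
    norm_num at hω
  set e := Literature.NumberTheory.EllipticCurves.absClosureEquiv ℚ K with he
  have hζ : (e.symm ω) ^ 3 = 1 := by rw [← map_pow, hω3, map_one]
  change absGaloisTransport (K := ℚ) (L := K) c₀ ω = ω ^ 2
  rw [absGaloisTransport_apply, RatClosure.smul_eq_inv_of_pow_eq_one hc₀ (by norm_num) hζ, map_inv₀,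
    AlgEquiv.apply_symm_apply]
  -- `ω⁻¹ = ω²`
  rw [inv_eq_of_mul_eq_one_right]
  rw [← pow_succ', hω3]

/-- **McCallum 1991, Cor. 3.2 at `p = 2` for `E_W : y² = x³ − c` over `K` imaginary quadratic with
`∛c ∉ K`, `ω ∉ K`** (given Čebotarev): independent `c`-eigenclasses `c_i ∈ H¹(K, E[2^M])`
(killed by `2^{e_i}`, `∑ aᵢcᵢ = 0 ⟹ 2^{eᵢ} ∣ aᵢ`) and exponents `N_i ≤ min(e_i, M)` acquire, above
every bound `b`, a prime `ℓ ∤ 2 N d_K`, inert in `K`, with `Frob(ℓ) = Frob(∞)` in `Gal(K(E_{2^M})/ℚ)`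
and `ord c_{i,λ} = 2^{N_i}` exactly at `λ ∋ ℓ` (`2^{N_i} c_i ∈ ker loc_λ`, `2^{N_i−1} c_i ∉ ker loc_λ`).
Step B at `2` (`exists_h1Eval_conj_mul_order_two`) + the tree's Steps C–G
(`exists_kolyvaginPrime_gt_of_galoisElement`). [cite: McCallumLMS1991, §3 Cor. 3.2] -/
theorem exists_kolyvaginPrime_gt_twoPow (hC : Literature.NumberTheory.Automorphic.chebotarev_artinRep) {N : ℕ} [NeZero N]
    (W : WeierstrassCurve ℚ) [W.IsElliptic] {C : VariableChange ℚ} {c : ℚ}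
    (hCW : C • W = ⟨0, 0, 0, 0, -c⟩) (hK : IsImaginaryQuadratic K)
    (hc : ∀ x : K, x ^ 3 ≠ (c : K)) (hωK : ∀ x : K, x ^ 2 + x + 1 ≠ 0)
    {M : ℕ} (hM : 1 ≤ M) {cK : K ≃ₐ[ℚ] K} (hcK : cK ≠ 1) {r : ℕ}
    (cs : Fin r → galH1Torsion (W.baseChange K) ((2 ^ M : ℕ) : ℤ))
    (hτ : ∀ i, ∃ e : ℤ, (e = 1 ∨ e = -1) ∧ conjAct W cK ((2 ^ M : ℕ) : ℤ) (cs i) = e • cs i)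
    (ex : Fin r → ℕ) (hex : ∀ i, ((2 : ℤ) ^ ex i) • cs i = 0)
    (hind : ∀ a : Fin r → ℤ, ∑ i, a i • cs i = 0 → ∀ i, ((2 : ℤ) ^ ex i) ∣ a i)
    (Nv : Fin r → ℕ) (hNe : ∀ i, Nv i ≤ ex i) (hNM : ∀ i, Nv i ≤ M) (b : ℕ) :
    ∃ ℓ : ℕ, b < ℓ ∧ ℓ.Prime ∧ ¬ ℓ ∣ N ∧ ¬ ((ℓ : ℤ) ∣ NumberField.discr K) ∧ ℓ ≠ 2 ∧
      (Ideal.span {(ℓ : 𝓞 K)}).IsPrime ∧ FrobEqFrobInfty W K (2 ^ M) ℓ ∧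
      ∀ i, ∀ v : HeightOneSpectrum (𝓞 K), (ℓ : 𝓞 K) ∈ v.asIdeal →
        (((2 : ℤ) ^ Nv i) • cs i ∈
            (W.baseChange K).torsionLocalKer (v.adicCompletion K) ((2 ^ M : ℕ) : ℤ) ∧
          (Nv i ≠ 0 → ((2 : ℤ) ^ (Nv i - 1)) • cs i ∉
            (W.baseChange K).torsionLocalKer (v.adicCompletion K) ((2 ^ M : ℕ) : ℤ))) := by
  -- complex conjugation and its involutive lift to `K̄`
  obtain ⟨c₀, hc₀⟩ := exists_isComplexConjugation (Rat.castHom ℝ)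
  have ht : IsLiftOfAut cK (absGaloisTransport (K := ℚ) (L := K) c₀).toRingEquiv :=
    RatClosure.isLiftOfAut_absGaloisTransport_of_isImaginaryQuadratic hK hcK hc₀
  have hinv : ∀ x, (absGaloisTransport (K := ℚ) (L := K) c₀).toRingEquiv
      ((absGaloisTransport (K := ℚ) (L := K) c₀).toRingEquiv x) = x := fun x ↦
    RatClosure.absGaloisTransport_absGaloisTransport_of_sq_eq_one hc₀.sq_eq_one x
  -- a primitive cube root of unity, inverted by `τ`
  obtain ⟨ω, hω⟩ : ∃ ω : AlgebraicClosure K, ω ^ 2 + ω + 1 = 0 := by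
    obtain ⟨ω, hω⟩ := IsAlgClosed.exists_root
      (Polynomial.X ^ 2 + Polynomial.X + 1 : Polynomial (AlgebraicClosure K))
      (by rw [show (Polynomial.X ^ 2 + Polynomial.X + 1 : Polynomial (AlgebraicClosure K)).degree
        = 2 by compute_degree!]; norm_num)
    exact ⟨ω, by simpa [Polynomial.IsRoot] using hω⟩
  have hτω := transport_smul_eq_sq_of_cube_root (K := K) hc₀ hω
  -- Step B at `2`
  choose ν hν using hτ
  obtain ⟨ρ, hρT, hρ⟩ := exists_h1Eval_conj_mul_order_two W hCW hc hωK ht hinv hω hτω hM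
    (fun i ↦ (hν i).1) (fun i ↦ (hν i).2) ex hex hind Nv hNe hNM
  -- Steps C–G (Čebotarev, p-independent in the tree)
  obtain ⟨ℓ, hbℓ, hℓ, hℓN, hℓD, hℓp, hprime, hfrob, m, hm, hloc⟩ :=
    exists_kolyvaginPrime_gt_of_galoisElement (N := N) hC hK Nat.prime_two hc₀ ht hinv cs hρT b
  refine ⟨ℓ, hbℓ, hℓ, hℓN, hℓD, hℓp, hprime, hfrob, fun i v hv ↦ ?_⟩
  have hρm : ρ * m ∈ torsionFixing (W.baseChange K) ((2 ^ M : ℕ) : ℤ) := mul_mem hρT hm.1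
  have hF : ht.conjGalCMH (ρ * m) * (ρ * m) ∈ torsionFixing (W.baseChange K) ((2 ^ M : ℕ) : ℤ) :=
    mul_mem (ht.conjGalCMH_mem_torsionFixing W hinv _ hρm) hρm
  have hspan : ∀ k : ℤ, k • cs i ∈ AddSubgroup.closure (Set.range cs) := fun k ↦
    AddSubgroup.zsmul_mem _ (AddSubgroup.subset_closure (Set.mem_range_self i)) _
  obtain ⟨hA, hB⟩ := hρ m hm i
  constructor
  · rw [hloc _ (hspan _) v hv, h1Eval_zsmul _ _ _ _ hF]
    exact hA
  · intro hN hmem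
    rw [hloc _ (hspan _) v hv, h1Eval_zsmul _ _ _ _ hF] at hmem
    exact hB hN hmem

/-- **McCallum's Cor. 3.2 at `p = 2` for `E_W : y² = x³ − c`, UNCONDITIONALLY** (the Čebotarev
density theorem is PROVED in the tree: `Automorphic.chebotarev_artinRep_holds`): the statement of
`exists_kolyvaginPrime_gt_twoPow` with its only named-fact hypothesis discharged.
[cite: McCallumLMS1991, §3 Cor. 3.2] -/
theorem exists_kolyvaginPrime_gt_twoPow_holds {N : ℕ} [NeZero N]
    (W : WeierstrassCurve ℚ) [W.IsElliptic] {C : VariableChange ℚ} {c : ℚ}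
    (hCW : C • W = ⟨0, 0, 0, 0, -c⟩) (hK : IsImaginaryQuadratic K)
    (hc : ∀ x : K, x ^ 3 ≠ (c : K)) (hωK : ∀ x : K, x ^ 2 + x + 1 ≠ 0)
    {M : ℕ} (hM : 1 ≤ M) {cK : K ≃ₐ[ℚ] K} (hcK : cK ≠ 1) {r : ℕ}
    (cs : Fin r → galH1Torsion (W.baseChange K) ((2 ^ M : ℕ) : ℤ))
    (hτ : ∀ i, ∃ e : ℤ, (e = 1 ∨ e = -1) ∧ conjAct W cK ((2 ^ M : ℕ) : ℤ) (cs i) = e • cs i)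
    (ex : Fin r → ℕ) (hex : ∀ i, ((2 : ℤ) ^ ex i) • cs i = 0)
    (hind : ∀ a : Fin r → ℤ, ∑ i, a i • cs i = 0 → ∀ i, ((2 : ℤ) ^ ex i) ∣ a i)
    (Nv : Fin r → ℕ) (hNe : ∀ i, Nv i ≤ ex i) (hNM : ∀ i, Nv i ≤ M) (b : ℕ) :
    ∃ ℓ : ℕ, b < ℓ ∧ ℓ.Prime ∧ ¬ ℓ ∣ N ∧ ¬ ((ℓ : ℤ) ∣ NumberField.discr K) ∧ ℓ ≠ 2 ∧
      (Ideal.span {(ℓ : 𝓞 K)}).IsPrime ∧ FrobEqFrobInfty W K (2 ^ M) ℓ ∧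
      ∀ i, ∀ v : HeightOneSpectrum (𝓞 K), (ℓ : 𝓞 K) ∈ v.asIdeal →
        (((2 : ℤ) ^ Nv i) • cs i ∈
            (W.baseChange K).torsionLocalKer (v.adicCompletion K) ((2 ^ M : ℕ) : ℤ) ∧
          (Nv i ≠ 0 → ((2 : ℤ) ^ (Nv i - 1)) • cs i ∉
            (W.baseChange K).torsionLocalKer (v.adicCompletion K) ((2 ^ M : ℕ) : ℤ))) :=
  exists_kolyvaginPrime_gt_twoPow (N := N) Literature.NumberTheory.Automorphic.chebotarev_artinRep_holds
    W hCW hK hc hωK hM hcK cs hτ ex hex hind Nv hNe hNM b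

/-- **Cor. 3.2 at `2` for the HSY curve `E_p` over an imaginary quadratic field `K ∌ ω`**: every
`ℚ`-model `W ≅ cubeSumCurve p` (`p` an odd prime), the hypothesis `∛(432p²) ∉ K` being DISCHARGED
(`SylvesterTwoFrame.cube_ne_432_mul_sq_of_finrank_eq_two`). [cite: McCallumLMS1991, §3 Cor. 3.2] -/
theorem exists_kolyvaginPrime_gt_twoPow_sylvester {N : ℕ} [NeZero N] {p : ℕ} (hp : p.Prime)
    (hp2 : p ≠ 2) (W : WeierstrassCurve ℚ) [W.IsElliptic]
    (hW : ∃ C : VariableChange ℚ, C • W = HuShuYin2019.cubeSumCurve (p : ℚ)) (hK : IsImaginaryQuadratic K)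
    (hωK : ∀ x : K, x ^ 2 + x + 1 ≠ 0)
    {M : ℕ} (hM : 1 ≤ M) {cK : K ≃ₐ[ℚ] K} (hcK : cK ≠ 1) {r : ℕ}
    (cs : Fin r → galH1Torsion (W.baseChange K) ((2 ^ M : ℕ) : ℤ))
    (hτ : ∀ i, ∃ e : ℤ, (e = 1 ∨ e = -1) ∧ conjAct W cK ((2 ^ M : ℕ) : ℤ) (cs i) = e • cs i)
    (ex : Fin r → ℕ) (hex : ∀ i, ((2 : ℤ) ^ ex i) • cs i = 0)
    (hind : ∀ a : Fin r → ℤ, ∑ i, a i • cs i = 0 → ∀ i, ((2 : ℤ) ^ ex i) ∣ a i)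
    (Nv : Fin r → ℕ) (hNe : ∀ i, Nv i ≤ ex i) (hNM : ∀ i, Nv i ≤ M) (b : ℕ) :
    ∃ ℓ : ℕ, b < ℓ ∧ ℓ.Prime ∧ ¬ ℓ ∣ N ∧ ¬ ((ℓ : ℤ) ∣ NumberField.discr K) ∧ ℓ ≠ 2 ∧
      (Ideal.span {(ℓ : 𝓞 K)}).IsPrime ∧ FrobEqFrobInfty W K (2 ^ M) ℓ ∧
      ∀ i, ∀ v : HeightOneSpectrum (𝓞 K), (ℓ : 𝓞 K) ∈ v.asIdeal →
        (((2 : ℤ) ^ Nv i) • cs i ∈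
            (W.baseChange K).torsionLocalKer (v.adicCompletion K) ((2 ^ M : ℕ) : ℤ) ∧
          (Nv i ≠ 0 → ((2 : ℤ) ^ (Nv i - 1)) • cs i ∉
            (W.baseChange K).torsionLocalKer (v.adicCompletion K) ((2 ^ M : ℕ) : ℤ))) := by
  obtain ⟨C, hCW⟩ := hW
  have hCW' : C • W = ⟨0, 0, 0, 0, -(432 * (p : ℚ) ^ 2)⟩ := by rw [hCW, HuShuYin2019.cubeSumCurve]; congr 1; ring
  have hc : ∀ x : K, x ^ 3 ≠ ((432 * (p : ℚ) ^ 2 : ℚ) : K) := fun x h =>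
    SylvesterTwoFrame.cube_ne_432_mul_sq_of_finrank_eq_two K hK.1 hp hp2 x
      (by rw [h]; simp)
  exact exists_kolyvaginPrime_gt_twoPow_holds (N := N) W hCW' hK hc hωK hM hcK cs hτ ex hex hind
    Nv hNe hNM b

/-- **The same for the partner `E_{3p²}`** (`W ≅ HuShuYin2019.cubeSumCurve (3p²)`, `∛(3888p⁴) ∉ K` discharged).
[cite: McCallumLMS1991, §3 Cor. 3.2] -/
theorem exists_kolyvaginPrime_gt_twoPow_sylvester_partner {N : ℕ} [NeZero N] {p : ℕ}
    (hp : p.Prime) (hp2 : p ≠ 2) (W : WeierstrassCurve ℚ) [W.IsElliptic]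
    (hW : ∃ C : VariableChange ℚ, C • W = HuShuYin2019.cubeSumCurve (3 * (p : ℚ) ^ 2))
    (hK : IsImaginaryQuadratic K) (hωK : ∀ x : K, x ^ 2 + x + 1 ≠ 0)
    {M : ℕ} (hM : 1 ≤ M) {cK : K ≃ₐ[ℚ] K} (hcK : cK ≠ 1) {r : ℕ}
    (cs : Fin r → galH1Torsion (W.baseChange K) ((2 ^ M : ℕ) : ℤ))
    (hτ : ∀ i, ∃ e : ℤ, (e = 1 ∨ e = -1) ∧ conjAct W cK ((2 ^ M : ℕ) : ℤ) (cs i) = e • cs i)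
    (ex : Fin r → ℕ) (hex : ∀ i, ((2 : ℤ) ^ ex i) • cs i = 0)
    (hind : ∀ a : Fin r → ℤ, ∑ i, a i • cs i = 0 → ∀ i, ((2 : ℤ) ^ ex i) ∣ a i)
    (Nv : Fin r → ℕ) (hNe : ∀ i, Nv i ≤ ex i) (hNM : ∀ i, Nv i ≤ M) (b : ℕ) :
    ∃ ℓ : ℕ, b < ℓ ∧ ℓ.Prime ∧ ¬ ℓ ∣ N ∧ ¬ ((ℓ : ℤ) ∣ NumberField.discr K) ∧ ℓ ≠ 2 ∧
      (Ideal.span {(ℓ : 𝓞 K)}).IsPrime ∧ FrobEqFrobInfty W K (2 ^ M) ℓ ∧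
      ∀ i, ∀ v : HeightOneSpectrum (𝓞 K), (ℓ : 𝓞 K) ∈ v.asIdeal →
        (((2 : ℤ) ^ Nv i) • cs i ∈
            (W.baseChange K).torsionLocalKer (v.adicCompletion K) ((2 ^ M : ℕ) : ℤ) ∧
          (Nv i ≠ 0 → ((2 : ℤ) ^ (Nv i - 1)) • cs i ∉
            (W.baseChange K).torsionLocalKer (v.adicCompletion K) ((2 ^ M : ℕ) : ℤ))) := by
  obtain ⟨C, hCW⟩ := hW
  have hCW' : C • W = ⟨0, 0, 0, 0, -(432 * (3 * (p : ℚ) ^ 2) ^ 2)⟩ := by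
    rw [hCW, HuShuYin2019.cubeSumCurve]; congr 1; ring
  have hc : ∀ x : K, x ^ 3 ≠ ((432 * (3 * (p : ℚ) ^ 2) ^ 2 : ℚ) : K) := fun x h =>
    cube_ne_3888_mul_pow_four_of_finrank_eq_two K hK.1 hp hp2 x
      (by rw [h]; simp)
  exact exists_kolyvaginPrime_gt_twoPow_holds (N := N) W hCW' hK hc hωK hM hcK cs hτ ex hex hind
    Nv hNe hNM b

end Summit.BirchSwinnertonDyer.BirchSwinnertonDyer.Theorems.SylvesterTwoUpper

end
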